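import Summits.QuantumFields.GaugeBoot.DiagonalRPGeometry
import Literature.RepresentationTheory.CompactGroups.UnitaryTrick
import HarnessLib

/-!
# Plaquettes and the diagonal mirror `x_i = x_j`: links, holonomies, the cut-plaquette identity
(gauge-boot, L3(β) part 2)

HONEST FRAMING (cell `pub-gaugeboot`, page 1 of every file): the venture produces certified bounds
on lattice expectations at stated coupling, gauge group, dimension and torus size; NOT a mass gap,
NOT a continuum limit, NOT a string tension; NOT Yang–Mills-summit-bearing (barriers
`FixedCouplingUltralocality`, `PerturbativeInvisibility`).

Continuation of `DiagonalRPGeometry.lean` (classes `IsPosPlaq / IsNegPlaq / IsCutPlaq /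
IsMirrorPlaq` of plaquettes of `ℤ^d` relative to the hyperplane `x_i = x_j`, the involutions
`edgeSwap`, `plaqSwap`, `Θ = configDiagSwapZd i j`):

* `plaquetteEdges_plaqSwap` — the links of the mirror image are the images of the links; links of
  positive plaquettes lie in the closed half `diagHalfEdges i j`, links of mirror plaquettes are
  mirror links, and the positive half `(x, i), (x + e_i, j)` of a cut plaquette consists of
  positive links;
* `plaquetteObs_configDiagSwapZd` — `Re tr ρ((ΘU)_p) = Re tr ρ(U_{plaqSwap p})` (orientation
  reversal is absorbed by `Re tr ρ(g⁻¹) = Re tr ρ(g)`, compact `G`, continuous `ρ`);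
* `plaquetteObs_eq_sum_halfPlaq` — **the cut-plaquette identity** (Osterwalder–Seiler 1978 §2;
  Kazakov–Zheng arXiv:2404.16925 p. 10 "plaquettes cut along the diagonal expand positively"): for
  a cut plaquette `p` with base point `x` on the mirror,
  `Re tr ρ(U_p) = ∑_{a,b} Re (σ(A_p(U))_{ab} conj σ(A_p(ΘU))_{ab})`, `A_p(U) = U(x,i) U(x+e_i,j)`
  the holonomy of its positive half (`halfPlaq`), `σ` the unitarised representation;
* `sum_plaquetteObs_split` — for a `plaqSwap`-symmetric finite set `Q` of plaquettes,
  `∑_{p ∈ Q} Re tr ρ(U_p) = A_Q(U) + A_Q(ΘU) + M_Q(U) + C_Q(U)` with `A_Q` the sum over the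
  positive plaquettes of `Q` (a function of the links in the closed half), `M_Q` the sum over the
  mirror plaquettes (a `Θ`-invariant function of the mirror links) and `C_Q` the sum over the cut
  plaquettes; and `sum_coeff_mul_conj` — `β C_Q(U) = ∑_ι a_ι(U) conj a_ι(ΘU)` is a Gram kernel in
  the half-plaquette entries (`β ≥ 0`).

No measure theory yet; that is `DiagonalRPFiniteVolume.lean`.

References: K. Osterwalder, E. Seiler, Ann. Phys. 110 (1978) 440, §2; E. Seiler, LNP 159 (1982)
Ch. 2; V. Kazakov, Z. Zheng, arXiv:2203.11360 §3.1, arXiv:2404.16925 §3.2 (p. 10).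
-/

noncomputable section

open Literature.Probability.LatticeModels (Site)
open Literature.MathematicalPhysics.QuantumLattice
open Literature.RepresentationTheory.CompactGroups

namespace Summit.QuantumFields.GaugeBoot

namespace DiagRP

variable {d : ℕ} {i j : Fin d}

/-! ## The links of a plaquette -/

/-- Membership in `plaquetteEdges`, unfolded. -/
theorem mem_plaquetteEdges_iff (p : ZdPlaquette d) (e : ZdEdge d) :
    e ∈ plaquetteEdges p ↔ e = (p.1, p.2.1.1) ∨ e = (p.1 + Pi.single p.2.1.1 1, p.2.1.2) ∨
      e = (p.1 + Pi.single p.2.1.2 1, p.2.1.1) ∨ e = (p.1, p.2.1.2) := by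
  simp only [plaquetteEdges, Finset.mem_insert, Finset.mem_singleton]

variable (i j)

/-- **The links of the mirror image are the mirror images of the links.** -/
theorem plaquetteEdges_plaqSwap (p : ZdPlaquette d) :
    plaquetteEdges (plaqSwap i j p) = (plaquetteEdges p).image (edgeSwap i j) := by
  obtain ⟨x, ⟨⟨k, l⟩, hkl⟩⟩ := p
  have hkl' : k < l := hkl
  ext e
  rw [Finset.mem_image, mem_plaquetteEdges_iff]
  simp only [mem_plaquetteEdges_iff]
  by_cases h : Equiv.swap i j k < Equiv.swap i j l
  · rw [plaqSwap_of_lt i j x hkl' h]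
    constructor
    · rintro (rfl | rfl | rfl | rfl)
      · exact ⟨_, Or.inl rfl, rfl⟩
      · exact ⟨_, Or.inr (Or.inl rfl), by simp [zdDiagSwap_add_single]⟩
      · exact ⟨_, Or.inr (Or.inr (Or.inl rfl)), by simp [zdDiagSwap_add_single]⟩
      · exact ⟨_, Or.inr (Or.inr (Or.inr rfl)), rfl⟩
    · rintro ⟨e', he', rfl⟩
      rcases he' with rfl | rfl | rfl | rfl <;> simp [zdDiagSwap_add_single]
  · rw [plaqSwap_of_not_lt i j x hkl' h]
    constructor
    · rintro (rfl | rfl | rfl | rfl)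
      · exact ⟨_, Or.inr (Or.inr (Or.inr rfl)), rfl⟩
      · exact ⟨_, Or.inr (Or.inr (Or.inl rfl)), by simp [zdDiagSwap_add_single]⟩
      · exact ⟨_, Or.inr (Or.inl rfl), by simp [zdDiagSwap_add_single]⟩
      · exact ⟨_, Or.inl rfl, rfl⟩
    · rintro ⟨e', he', rfl⟩
      rcases he' with rfl | rfl | rfl | rfl <;> simp [zdDiagSwap_add_single]

variable {i j}

/-- **All links of a positive plaquette lie in the closed half `{x_i ≥ x_j}`.** -/
theorem mem_diagHalfEdges_of_isPosPlaq (hij : i ≠ j) {p : ZdPlaquette d} (hp : IsPosPlaq i j p)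
    {e : ZdEdge d} (he : e ∈ plaquetteEdges p) : e ∈ diagHalfEdges i j := by
  obtain ⟨x, ⟨⟨k, l⟩, hkl⟩⟩ := p
  unfold IsPosPlaq HasDir at hp
  rw [mem_plaquetteEdges_iff] at he
  simp only at hp he
  rw [mem_diagHalfEdges_iff]
  rcases he with rfl | rfl | rfl | rfl <;>
    simp only [Pi.add_apply, Pi.single_apply] <;>
    by_cases hki : k = i <;> by_cases hkj : k = j <;> by_cases hli : l = i <;> by_cases hlj : l = j <;>
    simp_all <;> omega

/-- **All links of a mirror plaquette are mirror links.** -/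
theorem isMirrorEdge_of_isMirrorPlaq {p : ZdPlaquette d} (hp : IsMirrorPlaq i j p)
    {e : ZdEdge d} (he : e ∈ plaquetteEdges p) : IsMirrorEdge i j e := by
  obtain ⟨x, ⟨⟨k, l⟩, hkl⟩⟩ := p
  obtain ⟨h1, h2, h3⟩ := hp
  simp only [HasDir, not_or] at h1 h2 h3
  rw [mem_plaquetteEdges_iff] at he
  simp only at he
  unfold IsMirrorEdge
  rcases he with rfl | rfl | rfl | rfl
  · exact ⟨h1, h2.1, h3.1⟩
  · refine ⟨?_, h2.2, h3.2⟩
    simp only [Pi.add_apply, Pi.single_apply, if_neg (Ne.symm h2.1), if_neg (Ne.symm h3.1), h1]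
  · refine ⟨?_, h2.1, h3.1⟩
    simp only [Pi.add_apply, Pi.single_apply, if_neg (Ne.symm h2.2), if_neg (Ne.symm h3.2), h1]
  · exact ⟨h1, h2.2, h3.2⟩

/-- Links of a mirror plaquette lie in the closed half. -/
theorem mem_diagHalfEdges_of_isMirrorPlaq {p : ZdPlaquette d} (hp : IsMirrorPlaq i j p)
    {e : ZdEdge d} (he : e ∈ plaquetteEdges p) : e ∈ diagHalfEdges i j :=
  (isMirrorEdge_of_isMirrorPlaq hp he).mem_diagHalfEdges

/-- For a cut plaquette (base point `x` on the mirror), the two links `(x, i)` and `(x + e_i, j)`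
of its positive half lie in the closed half `{x_i ≥ x_j}` and are positive links. -/
theorem isPosEdge_of_isCutPlaq (hij : i ≠ j) {p : ZdPlaquette d} (hp : IsCutPlaq i j p) :
    IsPosEdge i j (p.1, i) ∧ IsPosEdge i j (p.1 + Pi.single i 1, j) := by
  obtain ⟨h1, -, -⟩ := hp
  have hi : (p.1 + Pi.single i (1 : ℤ) : Site d) i = p.1 i + 1 := by simp
  have hj : (p.1 + Pi.single i (1 : ℤ) : Site d) j = p.1 j := by simp [Ne.symm hij]
  refine ⟨⟨⟨h1.symm.le, fun h => absurd h hij⟩, fun h => h.2.1 rfl⟩,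
    ⟨⟨?_, fun _ => ?_⟩, fun h => h.2.2 rfl⟩⟩
  · show (p.1 + Pi.single i (1 : ℤ) : Site d) j ≤ (p.1 + Pi.single i (1 : ℤ) : Site d) i
    rw [hi, hj]; omega
  · show (p.1 + Pi.single i (1 : ℤ) : Site d) j + 1 ≤ (p.1 + Pi.single i (1 : ℤ) : Site d) i
    rw [hi, hj]; omega

/-! ## Holonomies under the swap -/

variable (i j)

/-- **`(ΘU)` has at `(x; k, l)` the holonomy of `U` at `(θx; (i j) k, (i j) l)`.** -/
theorem plaquetteHolonomyZd_configDiagSwapZd {G : Type*} [Group G] (U : LGConfig d G) (x : Site d)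
    (k l : Fin d) :
    plaquetteHolonomyZd (configDiagSwapZd i j U) x k l =
      plaquetteHolonomyZd U (zdDiagSwap i j x) (Equiv.swap i j k) (Equiv.swap i j l) := by
  simp only [plaquetteHolonomyZd, configDiagSwapZd_apply, edgeSwap_mk, zdDiagSwap_add_single]

/-- Reversing the orientation of a plaquette inverts its holonomy. -/
theorem plaquetteHolonomyZd_swap_dirs {G : Type*} [Group G] (U : LGConfig d G) (x : Site d)
    (k l : Fin d) : plaquetteHolonomyZd U x l k = (plaquetteHolonomyZd U x k l)⁻¹ := by
  simp only [plaquetteHolonomyZd, mul_inv_rev, inv_inv, mul_assoc]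

/-- The holonomy of `ΘU` around `p` is the holonomy of `U` around `plaqSwap p`, or its inverse
(according to whether the swap preserves or reverses the orientation of the plane). -/
theorem plaquetteHolonomyZd_configDiagSwapZd_eq_or {G : Type*} [Group G] (U : LGConfig d G)
    (p : ZdPlaquette d) :
    plaquetteHolonomyZd (configDiagSwapZd i j U) p.1 p.2.1.1 p.2.1.2 =
        plaquetteHolonomyZd U (plaqSwap i j p).1 (plaqSwap i j p).2.1.1 (plaqSwap i j p).2.1.2 ∨
      plaquetteHolonomyZd (configDiagSwapZd i j U) p.1 p.2.1.1 p.2.1.2 =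
        (plaquetteHolonomyZd U (plaqSwap i j p).1 (plaqSwap i j p).2.1.1 (plaqSwap i j p).2.1.2)⁻¹ := by
  obtain ⟨x, ⟨⟨k, l⟩, hkl⟩⟩ := p
  have hkl' : k < l := hkl
  rw [plaquetteHolonomyZd_configDiagSwapZd]
  by_cases h : Equiv.swap i j k < Equiv.swap i j l
  · rw [plaqSwap_of_lt i j x hkl' h]
    exact Or.inl rfl
  · rw [plaqSwap_of_not_lt i j x hkl' h]
    exact Or.inr (by rw [← plaquetteHolonomyZd_swap_dirs])

/-! ## Plaquette observables under the swap -/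

section Obs

variable {i j}
variable {N : ℕ} {G : Type*} [Group G] [TopologicalSpace G] [IsTopologicalGroup G] [CompactSpace G]
variable (ρ : G →* Matrix (Fin N) (Fin N) ℂ)

omit [TopologicalSpace G] [IsTopologicalGroup G] [CompactSpace G] in
/-- Plaquette observables are determined by the four links of the plaquette. -/
theorem plaquetteObs_congr (p : ZdPlaquette d) {U V : LGConfig d G}
    (h : ∀ e ∈ plaquetteEdges p, U e = V e) :
    plaquetteObs ρ p.1 p.2.1.1 p.2.1.2 U = plaquetteObs ρ p.1 p.2.1.1 p.2.1.2 V := by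
  have h1 := h _ ((mem_plaquetteEdges_iff p _).2 (Or.inl rfl))
  have h2 := h _ ((mem_plaquetteEdges_iff p _).2 (Or.inr (Or.inl rfl)))
  have h3 := h _ ((mem_plaquetteEdges_iff p _).2 (Or.inr (Or.inr (Or.inl rfl))))
  have h4 := h _ ((mem_plaquetteEdges_iff p _).2 (Or.inr (Or.inr (Or.inr rfl))))
  simp only [plaquetteObs, plaquetteHolonomyZd, h1, h2, h3, h4]

/-- **`Re tr ρ((ΘU)_p) = Re tr ρ(U_{plaqSwap p})`** (continuous representation of a compact
group: an orientation reversal does not change `Re tr ρ`). -/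
theorem plaquetteObs_configDiagSwapZd (hρ : Continuous ρ) (p : ZdPlaquette d) (U : LGConfig d G) :
    plaquetteObs ρ p.1 p.2.1.1 p.2.1.2 (configDiagSwapZd i j U) =
      plaquetteObs ρ (plaqSwap i j p).1 (plaqSwap i j p).2.1.1 (plaqSwap i j p).2.1.2 U := by
  unfold plaquetteObs
  rcases plaquetteHolonomyZd_configDiagSwapZd_eq_or i j U p with h | h
  · rw [h]
  · rw [h, CompactGroup.re_trace_map_inv ρ hρ]

/-- `Re tr ρ((ΘU)_{plaqSwap p}) = Re tr ρ(U_p)`. -/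
theorem plaquetteObs_plaqSwap_configDiagSwapZd (hρ : Continuous ρ) (p : ZdPlaquette d)
    (U : LGConfig d G) :
    plaquetteObs ρ (plaqSwap i j p).1 (plaqSwap i j p).2.1.1 (plaqSwap i j p).2.1.2
        (configDiagSwapZd i j U) = plaquetteObs ρ p.1 p.2.1.1 p.2.1.2 U := by
  rw [plaquetteObs_configDiagSwapZd ρ hρ, plaqSwap_plaqSwap]

/-- A mirror plaquette has the same observable in `U` and in `ΘU`. -/
theorem plaquetteObs_configDiagSwapZd_of_isMirrorPlaq (hρ : Continuous ρ) {p : ZdPlaquette d}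
    (hp : IsMirrorPlaq i j p) (U : LGConfig d G) :
    plaquetteObs ρ p.1 p.2.1.1 p.2.1.2 (configDiagSwapZd i j U) =
      plaquetteObs ρ p.1 p.2.1.1 p.2.1.2 U := by
  rw [plaquetteObs_configDiagSwapZd ρ hρ, plaqSwap_of_isMirrorPlaq hp]

/-! ## Splitting a symmetric sum of plaquette observables -/

/-- **The negative plaquettes of a `plaqSwap`-symmetric set contribute the positive ones of the
reflected configuration**: `∑_{p ∈ Q, Neg} Re tr ρ(U_p) = ∑_{p ∈ Q, Pos} Re tr ρ((ΘU)_p)`. -/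
theorem sum_neg_eq_sum_pos_configDiagSwapZd (hρ : Continuous ρ) {Q : Finset (ZdPlaquette d)}
    (hQ : ∀ p ∈ Q, plaqSwap i j p ∈ Q) (U : LGConfig d G) :
    ∑ p ∈ Q.filter (IsNegPlaq i j), plaquetteObs ρ p.1 p.2.1.1 p.2.1.2 U =
      ∑ p ∈ Q.filter (IsPosPlaq i j), plaquetteObs ρ p.1 p.2.1.1 p.2.1.2 (configDiagSwapZd i j U) := by
  refine Finset.sum_nbij' (plaqSwap i j) (plaqSwap i j) (fun p hp => ?_) (fun p hp => ?_)
    (fun p _ => plaqSwap_plaqSwap i j p) (fun p _ => plaqSwap_plaqSwap i j p) fun p _ => ?_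
  · rw [Finset.mem_filter] at hp ⊢
    exact ⟨hQ p hp.1, (isPosPlaq_plaqSwap_iff p).2 hp.2⟩
  · rw [Finset.mem_filter] at hp ⊢
    exact ⟨hQ p hp.1, (isNegPlaq_plaqSwap_iff p).2 hp.2⟩
  · rw [plaquetteObs_plaqSwap_configDiagSwapZd ρ hρ]

/-- The mirror plaquettes contribute a `Θ`-invariant amount. -/
theorem sum_mirror_configDiagSwapZd (hρ : Continuous ρ) (Q : Finset (ZdPlaquette d))
    (U : LGConfig d G) :
    ∑ p ∈ Q.filter (IsMirrorPlaq i j), plaquetteObs ρ p.1 p.2.1.1 p.2.1.2 (configDiagSwapZd i j U) =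
      ∑ p ∈ Q.filter (IsMirrorPlaq i j), plaquetteObs ρ p.1 p.2.1.1 p.2.1.2 U :=
  Finset.sum_congr rfl fun _ hp =>
    plaquetteObs_configDiagSwapZd_of_isMirrorPlaq ρ hρ (Finset.mem_filter.1 hp).2 U

/-- **Splitting of a symmetric plaquette sum along the diagonal mirror**: for a
`plaqSwap`-symmetric finite set `Q` of plaquettes,
`∑_{p ∈ Q} Re tr ρ(U_p) = A(U) + A(ΘU) + M(U) + C(U)`, with `A` the sum over the positive
plaquettes of `Q`, `M` over the mirror plaquettes and `C` over the cut plaquettes. -/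
theorem sum_plaquetteObs_split (hρ : Continuous ρ) {Q : Finset (ZdPlaquette d)}
    (hQ : ∀ p ∈ Q, plaqSwap i j p ∈ Q) (U : LGConfig d G) :
    ∑ p ∈ Q, plaquetteObs ρ p.1 p.2.1.1 p.2.1.2 U =
      ∑ p ∈ Q.filter (IsPosPlaq i j), plaquetteObs ρ p.1 p.2.1.1 p.2.1.2 U +
      ∑ p ∈ Q.filter (IsPosPlaq i j), plaquetteObs ρ p.1 p.2.1.1 p.2.1.2 (configDiagSwapZd i j U) +
      ∑ p ∈ Q.filter (IsMirrorPlaq i j), plaquetteObs ρ p.1 p.2.1.1 p.2.1.2 U +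
      ∑ p ∈ Q.filter (IsCutPlaq i j), plaquetteObs ρ p.1 p.2.1.1 p.2.1.2 U := by
  rw [← sum_neg_eq_sum_pos_configDiagSwapZd ρ hρ hQ U]
  set f : ZdPlaquette d → ℝ := fun p => plaquetteObs ρ p.1 p.2.1.1 p.2.1.2 U
  have h1 := Finset.sum_filter_add_sum_filter_not Q (IsPosPlaq i j) f
  have h2 := Finset.sum_filter_add_sum_filter_not (Q.filter fun p => ¬ IsPosPlaq i j p)
    (IsCutPlaq i j) f
  have h3 := Finset.sum_filter_add_sum_filter_not
    ((Q.filter fun p => ¬ IsPosPlaq i j p).filter fun p => ¬ IsCutPlaq i j p) (IsMirrorPlaq i j) f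
  have e2 : (Q.filter fun p => ¬ IsPosPlaq i j p).filter (IsCutPlaq i j) = Q.filter (IsCutPlaq i j) := by
    rw [Finset.filter_filter]
    exact Finset.filter_congr fun p _ => ⟨fun h => h.2, fun h => ⟨fun h' => h'.not_isCutPlaq h, h⟩⟩
  have e3 : ((Q.filter fun p => ¬ IsPosPlaq i j p).filter fun p => ¬ IsCutPlaq i j p).filter
      (IsMirrorPlaq i j) = Q.filter (IsMirrorPlaq i j) := by
    rw [Finset.filter_filter, Finset.filter_filter]
    exact Finset.filter_congr fun p _ =>
      ⟨fun h => h.2.2, fun h => ⟨fun h' => h'.not_isMirrorPlaq h, fun h' => h'.not_isMirrorPlaq h, h⟩⟩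
  have e4 : ((Q.filter fun p => ¬ IsPosPlaq i j p).filter fun p => ¬ IsCutPlaq i j p).filter
      (fun p => ¬ IsMirrorPlaq i j p) = Q.filter (IsNegPlaq i j) := by
    rw [Finset.filter_filter, Finset.filter_filter]
    exact Finset.filter_congr fun p _ => (isNegPlaq_iff_not p).symm
  rw [e2] at h2
  rw [e3, e4] at h3
  linarith

/-! ## The cut-plaquette identity -/

variable (i j) in
/-- The holonomy of the POSITIVE HALF of a cut plaquette with base point `x`: the path
`x → x + e_i → x + e_i + e_j`, `A_p(U) = U(x, i) U(x + e_i, j)`. Its mirror image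
`A_p(ΘU) = U(x, j) U(x + e_j, i)` is the other half, and `U_p = A_p(U) A_p(ΘU)⁻¹` (up to
orientation). -/
def halfPlaq (p : ZdPlaquette d) (U : LGConfig d G) : G := U (p.1, i) * U (p.1 + Pi.single i 1, j)

omit [TopologicalSpace G] [IsTopologicalGroup G] [CompactSpace G] in
/-- The half plaquette of `ΘU` at a cut plaquette is the other half: `U(x, j) U(x + e_j, i)`. -/
theorem halfPlaq_configDiagSwapZd {p : ZdPlaquette d} (hp : IsCutPlaq i j p) (U : LGConfig d G) :
    halfPlaq i j p (configDiagSwapZd i j U) = U (p.1, j) * U (p.1 + Pi.single j 1, i) := by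
  simp only [halfPlaq, configDiagSwapZd_apply, edgeSwap_mk, zdDiagSwap_add_single,
    zdDiagSwap_of_eq i j hp.1, Equiv.swap_apply_left, Equiv.swap_apply_right]

omit [TopologicalSpace G] [IsTopologicalGroup G] [CompactSpace G] in
/-- The half plaquette is determined by its two links. -/
theorem halfPlaq_congr (p : ZdPlaquette d) {U V : LGConfig d G} (h1 : U (p.1, i) = V (p.1, i))
    (h2 : U (p.1 + Pi.single i 1, j) = V (p.1 + Pi.single i 1, j)) :
    halfPlaq i j p U = halfPlaq i j p V := by
  simp only [halfPlaq, h1, h2]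

/-- `Re (z conj w) = Re (w conj z)`. -/
theorem re_mul_conj_comm (z w : ℂ) : (z * (starRingEnd ℂ) w).re = (w * (starRingEnd ℂ) z).re := by
  simp only [Complex.mul_re, Complex.conj_re, Complex.conj_im]; ring

/-- **The cut-plaquette identity** (Osterwalder–Seiler 1978 §2; Kazakov–Zheng arXiv:2404.16925
p. 10): for a cut plaquette `p`,
`Re tr ρ(U_p) = ∑_{a,b} Re (σ(A_p(U))_{ab} conj σ(A_p(ΘU))_{ab})`, `σ` the unitarised
representation — a Gram kernel between the positive half and its mirror image. -/
theorem plaquetteObs_eq_sum_halfPlaq (hρ : Continuous ρ) (hij : i ≠ j) {p : ZdPlaquette d}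
    (hp : IsCutPlaq i j p) (U : LGConfig d G) :
    plaquetteObs ρ p.1 p.2.1.1 p.2.1.2 U = ∑ a, ∑ b,
      (CompactGroup.unitarize ρ hρ (halfPlaq i j p U) a b *
        (starRingEnd ℂ) (CompactGroup.unitarize ρ hρ (halfPlaq i j p (configDiagSwapZd i j U)) a b)).re := by
  rw [halfPlaq_configDiagSwapZd hp]
  obtain ⟨x, ⟨⟨k, l⟩, hkl⟩⟩ := p
  obtain ⟨-, hI, hJ⟩ := hp
  simp only [HasDir] at hI hJ
  unfold plaquetteObs halfPlaq
  simp only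
  have hkl' : k ≠ l := ne_of_lt hkl
  rcases hI with rfl | rfl <;> rcases hJ with h | h
  · exact absurd h hij
  · subst h
    rw [show plaquetteHolonomyZd U x k l = (U (x, k) * U (x + Pi.single k 1, l)) *
        (U (x, l) * U (x + Pi.single l 1, k))⁻¹ by
          simp only [plaquetteHolonomyZd, mul_inv_rev, mul_assoc],
      CompactGroup.re_trace_mul_inv_eq_sum ρ hρ]
  · subst h
    rw [show plaquetteHolonomyZd U x k l = (U (x, k) * U (x + Pi.single k 1, l)) *
        (U (x, l) * U (x + Pi.single l 1, k))⁻¹ by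
          simp only [plaquetteHolonomyZd, mul_inv_rev, mul_assoc],
      CompactGroup.re_trace_mul_inv_eq_sum ρ hρ]
    simp_rw [re_mul_conj_comm (CompactGroup.unitarize ρ hρ (U (x, k) * U (x + Pi.single k 1, l)) _ _)]
  · exact absurd h hij

end Obs

end DiagRP

end Summit.QuantumFields.GaugeBoot
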